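import Literature.NumberTheory.EllipticCurves.Shintani32KohnenLiftCusp
import Literature.NumberTheory.EllipticCurves.ModularSymbolsProofs
import Literature.NumberTheory.EllipticCurves.CongruentNewformLevel32
import Literature.NumberTheory.QuadraticFields.JacobiCharacter
import HarnessLib

/-!
# The diagonal coefficient `a_{G_D}(D)` of the Kohnen-type lift: orbit data, orbit classification, evaluation

[[cite: Shintani1975, §2, Lemma 2.7 (ii), §3]] [[cite: Tunnell1983Congruent, p. 329]]
[[cite: Manin1972, Thm. 1.6]] — hypothesis (H3) of the symmetric-family endgame for the
normalized Kohnen-type lifts `G_D = (2/√D) Φ_D` (`Shintani32KohnenLiftCusp.kohnenFamily`) of a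
weight-`2` cusp form `φ` on `Γ₀(32)`: `a_{G_D}(D) = ∑_{ω : Δ(k_ω) = D²} χ_{D*}(Q_ω) u(ω)`, and

1. **The orbit datum at ANY representative** (`orbDatum_eq_of_rep`): for a split orbit and
   `k ∈ ω` with `x₀ ≠ 0`, `u(ω) = ({∞, q₁(k)}_φ - {∞, q₂(k)}_φ)/(2πi)` (the orbit integral does
   not depend on the base point; the canonicity of orbit data is weight-free); on the classes of
   `kA D j = (0, D, j)` (`Q = Dxy + jy²`, moved by `g = (1 0; 32 1)` to `(32j - D, D - 64j, j)`)
   the Manin relation (`modularSymbol_gamma0_smul_holds`) cancels the cusp symbols: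
   `u(⟦kA D j⟧) = -{∞,-j/D}_φ/(2πi)`, `u(⟦-kA D j⟧) = +{∞,-j/D}_φ/(2πi)`
   (`orbDatum_kA`, `orbDatum_neg_kA`).
2. **Classification** (`exists_smul_eq_kA_or_neg`): every `k` with `Δ(k) = D²` (`D` odd) is
   `Γ₀(32)⁺`-equivalent to `±kA D j` with `0 ≤ j < D` (one isotropic line `64k₀s + (k₁ ∓ D)t = 0`
   has a primitive direction with `32 ∣ t`; an element of `Γ₀(32)⁺` with bottom row `(-t, s)`
   kills the leading coefficient; a translation normalises `j`), and these `2D` classes are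
   pairwise distinct (`classMap_injective`).
3. **Evaluation** (`qCoeffs_kohnenFamily_diag`): `χ_{D*}(±kA D j) = ±(j/D)` and the two halves
   agree, so `a_{G_D}(D) = -(πi)⁻¹ ∑_j (j/D){∞,-j/D}_φ = (πi)⁻¹ ∑_{a mod D} (a/D) {∞, a/D}_φ`
   (`twistedSymbolSum`; `(-1/D) = -1`) for `D ≡ 3 (mod 4)` square-free and ANY `φ ∈ S₂(Γ₀(32))`.

No named facts; definitions `kA`, `gLow` (the tree's `gamma0Gen` in `Γ₀(32)⁺`), `transl`, `classMap`, `diagSummand`.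
-/

noncomputable section

open scoped MatrixGroups ModularForm Modular Topology Pointwise
open Complex Real MeasureTheory Set Filter CongruenceSubgroup ModularGroup MulAction
open UpperHalfPlane hiding I
open Literature.NumberTheory.EllipticCurves.ModularForms
open Literature.NumberTheory.EllipticCurves.Tunnell1983 (gamma0Gen gamma0Gen_00 gamma0Gen_01 gamma0Gen_10
  gamma0Gen_11 gamma0Gen_mem)

namespace Literature.NumberTheory.EllipticCurves.Shintani

/-! ### The orbit integral does not depend on the base point -/

/-- For `k` in the orbit of `k₀`: `∫_{F_k} term(k) = ∫_{F_{k₀}} term(k₀)` (both are the sum of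
`∫_F term(x)` over the orbit). [folklore] -/
theorem integral_orbitDomain32_eq_of_mem_orbit {cw : (Fin 3 → ℤ) → ℂ} (hinv : InvWeight32 cw)
    (hb : BddWeight cw) (tS : ℝ) (htS : 0 < tS) (f : CuspForm (Gamma0 32) 2) (z : ℍ)
    {k k₀ : Fin 3 → ℤ} (hk : k ∈ MulAction.orbit (Gamma0Plus 32) k₀) :
    ∫ w in orbitDomain32 k, liftTermG cw tS htS f z k w = ∫ w in orbitDomain32 k₀, liftTermG cw tS htS f z k₀ w := by
  set F : (Fin 3 → ℤ) → ℂ := fun x ↦ ∫ w in liftDomain32, liftTermG cw tS htS f z x w with hF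
  have h1 := (tsum_quotient_integral_liftTermG_eq hinv hb tS htS f z k).2
  have h2 := (tsum_quotient_integral_liftTermG_eq hinv hb tS htS f z k₀).2
  rw [← h1, ← h2, ← tsum_orbit_eq_tsum_quotient_stabilizer (G := Gamma0Plus 32) F k,
    ← tsum_orbit_eq_tsum_quotient_stabilizer (G := Gamma0Plus 32) F k₀]
  have horb : MulAction.orbit (Gamma0Plus 32) k = MulAction.orbit (Gamma0Plus 32) k₀ :=
    MulAction.orbit_eq_iff.mpr hk
  exact (Equiv.setCongr horb).tsum_eq (fun x : MulAction.orbit (Gamma0Plus 32) k₀ ↦ F x)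

/-! ### The split orbit integral at a base vector -/

/-- **The split orbit integral over `F_k` for any conjugating matrix** (`Δ(k) = m₀² > 0`,
`ι♮(k) ∘ M = λXY`). [cite: Shintani1975, §2, Prop. 2.4] -/
theorem integral_orbitDomain32_split_of_conj (f : CuspForm (Gamma0 32) 2)
    (k₀ : Fin 3 → ℤ) {m₀ : ℤ} (hm₀ : 0 < m₀)
    (hΔ : discK k₀ = m₀ ^ 2) {M : SL(2, ℝ)} {lam : ℝ}
    (hM : actSL M (latSharp32 k₀) = xyForm lam) {cw : (Fin 3 → ℤ) → ℂ} (hinv : InvWeight32 cw)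
    (hb : BddWeight cw) (tS : ℝ) (htS : 0 < tS) (z : ℍ) :
    ∫ w in orbitDomain32 k₀, liftTermG cw tS htS f z k₀ w = anisoConstG cw tS htS z k₀ lam *
        (∫ r in Ioi (0 : ℝ), slashSL f M (polarPt r (π / 2)) * unitAt (π / 2)) *
          (Real.sqrt (π / (4 * π * (mulPos tS htS z : ℂ).im * lam ^ 2)) : ℝ) := by
  obtain ⟨⟨A, Nu, hN, hMfac⟩, ⟨A', Nu', hN', hPfac⟩⟩ := exists_factorizations_of_sq32 hm₀ hΔ hM
  have hbot := stabK_eq_bot_of_sq32 hm₀ hΔ (k₀ := k₀)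
  haveI : Subsingleton (stabK32 k₀) := by rw [hbot]; infer_instance
  have hFD := isFundamentalDomain_orbitDomain32 k₀
  have hFD' : IsFundamentalDomain (stabK32 k₀) (Set.univ : Set ℍ) (volume : Measure ℍ) :=
    isFundamentalDomain_univ_of_subsingleton
  have hstab : ∀ (γ : stabK32 k₀) (w : ℍ), liftTermG cw tS htS f z k₀ (γ • w) = liftTermG cw tS htS f z k₀ w :=
    liftTermG_stab_invariant hinv tS htS f z k₀
  have hintH : IntegrableOn (liftTermG cw tS htS f z k₀) Set.univ (volume : Measure ℍ) :=
    (hFD.integrableOn_iff hFD' hstab).mp (tsum_quotient_integral_liftTermG_eq hinv hb tS htS f z k₀).1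
  have hintM : IntegrableOn (fun u ↦ liftTermG cw tS htS f z k₀ (M • u)) Set.univ (volume : Measure ℍ) := by
    rw [← integrableOn_sl_smul_set_real_iff M, Set.smul_set_univ]; exact hintH
  set ψ : ℂ → ℂ := fun τ ↦ slashSL f M τ * anisoConstG cw tS htS z k₀ lam with hψdef
  set cc : ℝ := 4 * π * (mulPos tS htS z : ℂ).im * lam ^ 2 with hcc
  have hcpos : 0 < cc := by
    have h1 : 0 < (mulPos tS htS z : ℂ).im := by rw [UpperHalfPlane.coe_im]; exact (mulPos tS htS z).im_pos
    have hl : lam ≠ 0 := by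
      intro h0
      have h := lam_sq_eq_disc hM
      rw [h0, disc_latSharp32_eq_discK, hΔ] at h
      have : (0 : ℝ) < (m₀ : ℝ) ^ 2 := by positivity
      push_cast at h
      linarith
    positivity
  have hplane_eq : ∀ w : ℂ, 0 < w.im →
      ((1 / w.im ^ 2 : ℝ) : ℂ) * liftTermG cw tS htS f z k₀ (M • UpperHalfPlane.ofComplex w) = planeIntegrand ψ cc w := by
    intro w hw
    rw [liftTermG_sl_smul cw tS htS f z hM, planeIntegrand, UpperHalfPlane.ofComplex_apply_of_im_pos hw]
  have hplane : IntegrableOn (planeIntegrand ψ cc) {w : ℂ | 0 < w.im} := by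
    have h := (FdCoord.integrableOn_image_iff (fun u ↦ liftTermG cw tS htS f z k₀ (M • u)) MeasurableSet.univ).mpr hintM
    rw [image_univ, UpperHalfPlane.range_coe] at h
    exact h.congr_fun (fun w hw ↦ hplane_eq w hw) (measurableSet_lt measurable_const Complex.measurable_im)
  obtain ⟨C₀, -, hC₀⟩ := exists_norm_mul_im_le f
  have hCψ : ∀ w : ℂ, 0 < w.im → ‖ψ w‖ * w.im ≤ C₀ * ‖anisoConstG cw tS htS z k₀ lam‖ := by
    intro w hw
    calc ‖slashSL f M w * anisoConstG cw tS htS z k₀ lam‖ * w.im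
        = (‖slashSL f M w‖ * w.im) * ‖anisoConstG cw tS htS z k₀ lam‖ := by rw [norm_mul]; ring
      _ ≤ C₀ * ‖anisoConstG cw tS htS z k₀ lam‖ :=
        mul_le_mul_of_nonneg_right (norm_slashSL_mul_im_le32 f M hC₀ hw) (norm_nonneg _)
  have hψhol : DifferentiableOn ℂ ψ {w : ℂ | 0 < w.im} := (differentiableOn_slashSL32 f M).mul_const _
  have key := integral_sectorSet_Ioi_eq_mul_sqrt (ψ := ψ) (c := cc) hψhol hCψ
    (fun y hy ↦ tendsto_slashSL_mul_nhdsGT_zero32 f hN' hPfac _ hy)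
    (fun y hy ↦ tendsto_slashSL_mul_atTop32 f hN hMfac _ hy)
    (fun θ hθ ↦ integrableOn_ray32 f hN hMfac hN' hPfac _ hθ)
    (integrableOn_polarIntegrand_of_plane hψhol.continuousOn hplane)
  rw [hFD.setIntegral_eq hFD' hstab, ← Set.smul_set_univ (a := M), setIntegral_sl_smul_set_real,
    FdCoord.setIntegral_eq_setIntegral_image _ MeasurableSet.univ, image_univ, UpperHalfPlane.range_coe]
  rw [show (UpperHalfPlane.upperHalfPlaneSet : Set ℂ) = {w : ℂ | 0 < w.im} from rfl,
    setIntegral_congr_fun (measurableSet_lt measurable_const Complex.measurable_im) (fun w hw ↦ hplane_eq w hw),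
    setOf_im_pos_eq_sectorSet, key]
  have hray : ∫ r in Ioi (0 : ℝ), ψ (polarPt r (π / 2)) * unitAt (π / 2) =
      anisoConstG cw tS htS z k₀ lam * ∫ r in Ioi (0 : ℝ), slashSL f M (polarPt r (π / 2)) * unitAt (π / 2) := by
    rw [← integral_const_mul]
    refine integral_congr_ae (Eventually.of_forall fun r ↦ ?_)
    simp only [hψdef]; ring
  rw [hray]

/-! ### The orbit datum at an arbitrary representative -/

/-- The constant weight `1` is admissible. [folklore] -/
theorem invWeight32_one : InvWeight32 (fun _ : Fin 3 → ℤ ↦ (1 : ℂ)) := fun _ _ _ _ _ _ ↦ rfl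

/-- The constant weight `1` is bounded. [folklore] -/
theorem bddWeight_one : BddWeight (fun _ : Fin 3 → ℤ ↦ (1 : ℂ)) := ⟨1, fun _ ↦ by simp⟩

/-- Discriminants are constant on orbits. [folklore] -/
theorem discK_eq_of_mem_orbit {k k₀ : Fin 3 → ℤ} (hk : k ∈ MulAction.orbit (Gamma0Plus 32) k₀) :
    discK k = discK k₀ := by
  obtain ⟨g, rfl⟩ := hk
  have h := disc_latSharp32_smul g k₀
  rw [disc_latSharp32_eq_discK, disc_latSharp32_eq_discK] at h
  exact_mod_cast h

/-- **The orbit datum of a split orbit by modular symbols, at ANY representative** `k ∈ ω` with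
`x₀ = 32k₀ ≠ 0`: `u(ω) = ({∞, q₁}_φ - {∞, q₂}_φ)/(2πi)`, `q₁ = (-x₁ - m₀)/(2x₀)`,
`q₂ = (-x₁ + m₀)/(2x₀)`. [cite: Shintani1975, §2, Lemma 2.7 (ii)] -/
theorem orbDatum_eq_of_rep (f : CuspForm (Gamma0 32) 2)
    (ω : orbitRel.Quotient (Gamma0Plus 32) (Fin 3 → ℤ)) {k : Fin 3 → ℤ}
    (hk : k ∈ MulAction.orbit (Gamma0Plus 32) ω.out) {m₀ : ℤ} (hm₀ : 0 < m₀)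
    (hΔ : discK k = m₀ ^ 2) (hx0 : latSharp32 k 0 ≠ 0) {q₁ q₂ : ℚ}
    (hq₁ : (q₁ : ℝ) = (-latSharp32 k 1 - m₀) / (2 * latSharp32 k 0))
    (hq₂ : (q₂ : ℝ) = (-latSharp32 k 1 + m₀) / (2 * latSharp32 k 0)) :
    orbDatum f ω = (modularSymbol f q₁ - modularSymbol f q₂) / (2 * Real.pi * I) := by
  have hΔ₀ : discK ω.out = m₀ ^ 2 := by rw [← discK_eq_of_mem_orbit hk, hΔ]
  have hpos : 0 < discK ω.out := by rw [hΔ₀]; positivity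
  set x := latSharp32 k with hx
  have hdiscR : disc x = ((m₀ : ℝ)) ^ 2 := by
    rw [hx, disc_latSharp32_eq_discK, hΔ]; push_cast; ring
  have hposR : 0 < disc x := by rw [hdiscR]; exact pow_pos (by exact_mod_cast hm₀) 2
  have hsqrt : Real.sqrt (disc x) = m₀ := by rw [hdiscR, Real.sqrt_sq (by exact_mod_cast hm₀.le)]
  obtain ⟨a, b, c, d, hdet, hM, hc, hd0, hcol1, hcol2⟩ := exists_conj_explicit hx0 hposR
  rw [hsqrt] at hM hcol1 hcol2
  set M : SL(2, ℝ) := slOf a b c d hdet with hMdef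
  have hm₀R : (m₀ : ℝ) ≠ 0 := by exact_mod_cast hm₀.ne'
  obtain ⟨⟨A, Nu, hN, hMfac⟩, ⟨A', Nu', hN', hPfac⟩⟩ := exists_factorizations_of_sq32 hm₀ hΔ hM
  -- the orbit data `(m₀, P)` at `k`, valid for EVERY admissible weight (base point moved to `k`)
  set P : ℂ := ∫ r in Ioi (0 : ℝ), slashSL f M (polarPt r (π / 2)) * unitAt (π / 2) with hP
  have hJ : ∀ (cw : (Fin 3 → ℤ) → ℂ) (tS : ℝ) (htS : 0 < tS), InvWeight32 cw → BddWeight cw → ∀ z : ℍ,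
      orbitIntegralG cw tS htS f z ω = anisoConstG cw tS htS z ω.out m₀ * P *
        (Real.sqrt (π / (4 * π * (mulPos tS htS z : ℂ).im * (m₀ : ℝ) ^ 2)) : ℝ) := by
    intro cw tS htS hinv hb z
    unfold orbitIntegralG
    rw [← integral_orbitDomain32_eq_of_mem_orbit hinv hb tS htS f z hk,
      integral_orbitDomain32_split_of_conj f k hm₀ hΔ hM hinv hb tS htS z]
    -- the weight is constant on the orbit
    have hcw : cw k = cw ω.out := by
      obtain ⟨g, rfl⟩ := hk
      show cw (g • ω.out) = cw ω.out
      rw [smul_def32]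
      exact hinv _ _ _ _ (by
        have := det_eq_one' ((g : Gamma0Plus 32) : SL(2, ℤ))
        rw [← thirtytwo_mul_cq32 g] at this
        linear_combination this) ω.out
    rw [anisoConstG, anisoConstG, hcw]
  -- the canonical data `(λ₀, P₀)` agree with `(m₀, P)` up to the weight-free canonicity
  unfold orbDatum
  rw [dif_pos hpos]
  set lam₀ := (exists_orbit_dataG f ω hpos).choose
  set P₀ := (exists_orbit_dataG f ω hpos).choose_spec.choose
  obtain ⟨hlam₀, hl2₀, hJ₀⟩ := (exists_orbit_dataG f ω hpos).choose_spec.choose_spec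
  have hl2 : (m₀ : ℝ) ^ 2 = discK ω.out := by rw [hΔ₀]; push_cast; ring
  have hsq : lam₀ ^ 2 = (m₀ : ℝ) ^ 2 := by rw [hl2₀, hl2]
  have hcan := weight_mul_data_eq (fun _ ↦ (1 : ℂ)) 1 one_pos UpperHalfPlane.I hlam₀ hsq
    (hJ₀ (fun _ ↦ (1 : ℂ)) 1 one_pos invWeight32_one bddWeight_one UpperHalfPlane.I)
    (hJ (fun _ ↦ (1 : ℂ)) 1 one_pos invWeight32_one bddWeight_one UpperHalfPlane.I)
  simp only [one_mul] at hcan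
  -- `P = ({∞,q₁} - {∞,q₂})/(2πi)`
  have hPval : P = (modularSymbol f q₁ - modularSymbol f q₂) / (2 * Real.pi * I) := by
    rw [hP, period_eq_cuspValue32_sub f hN hMfac hN' hPfac]
    have hM10 : (M 1 0 : ℝ) ≠ 0 := by simp [hMdef, slOf, hc]
    have hM00 : (M 0 0 : ℝ) / (M 1 0 : ℝ) = a / c := by simp [hMdef, slOf]
    obtain ⟨hP00, hP10⟩ := mul_S_inv_col M
    have hP10ne : ((M * (((ModularGroup.S : SL(2, ℤ)) : SL(2, ℝ)))⁻¹ : SL(2, ℝ)) 1 0 : ℝ) ≠ 0 := by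
      rw [hP10]; simp [hMdef, slOf, hd0]
    have hPratio : ((M * (((ModularGroup.S : SL(2, ℤ)) : SL(2, ℝ)))⁻¹ : SL(2, ℝ)) 0 0 : ℝ) /
        ((M * (((ModularGroup.S : SL(2, ℤ)) : SL(2, ℝ)))⁻¹ : SL(2, ℝ)) 1 0 : ℝ) = b / d := by
      rw [hP00, hP10, neg_div_neg_eq]; simp [hMdef, slOf]
    rw [cuspValue32_eq_modularSymbol f hN hMfac hM10 (q := q₁) (by rw [hq₁, hM00, hcol1]),
      cuspValue32_eq_modularSymbol f hN' hPfac hP10ne (q := q₂) (by rw [hq₂, hPratio, hcol2])]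
  -- `λ₀ P₀ = m₀ P` and `|λ₀| = m₀`
  have habs : |lam₀| = (m₀ : ℝ) := by
    rw [← Real.sqrt_sq_eq_abs, hsq, Real.sqrt_sq (by exact_mod_cast hm₀.le)]
  rw [habs, ← hPval]
  have hm₀C : ((m₀ : ℝ) : ℂ) ≠ 0 := Complex.ofReal_ne_zero.mpr hm₀R
  calc (((lam₀ / (m₀ : ℝ) : ℝ)) : ℂ) * P₀ = ((lam₀ : ℂ) * P₀) / (m₀ : ℝ) := by push_cast; field_simp
    _ = (((m₀ : ℝ) : ℂ) * P) / (m₀ : ℝ) := by rw [hcan]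
    _ = P := by field_simp

/-! ### The type-A representatives `Q = D xy + j y²` and their orbit data -/

/-- **The type-A form** `Q = D xy + j y²`, coordinates `(0, D, j)`. [folklore] -/
def kA (D : ℕ) (j : ℤ) : Fin 3 → ℤ := ![0, (D : ℤ), j]

/-- `kA_apply_zero` (coordinate). [folklore] -/
@[simp] theorem kA_apply_zero (D : ℕ) (j : ℤ) : kA D j 0 = 0 := rfl
/-- `kA_apply_one` (coordinate). [folklore] -/
@[simp] theorem kA_apply_one (D : ℕ) (j : ℤ) : kA D j 1 = D := rfl
/-- `kA_apply_two` (coordinate). [folklore] -/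
@[simp] theorem kA_apply_two (D : ℕ) (j : ℤ) : kA D j 2 = j := rfl

/-- `γ₀ = (1 0; 32 1)` (`CongruentNewformLevel32.gamma0Gen`) lies in `Γ₀(32)⁺`. [folklore] -/
theorem gamma0Gen_mem_plus : gamma0Gen ∈ Gamma0Plus 32 := by
  have h1 : gamma0Gen ∈ Gamma1 4 := by rw [Gamma1_mem, gamma0Gen_00, gamma0Gen_11, gamma0Gen_10]; decide
  exact Subgroup.mem_inf.mpr ⟨gamma0Gen_mem, h1⟩

/-- `g = γ₀ = (1 0; 32 1)` as an element of `Γ₀(32)⁺`. [folklore] -/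
def gLow : Gamma0Plus 32 := ⟨gamma0Gen, gamma0Gen_mem_plus⟩

/-- `g • kA = (32j - D, D - 64j, j)`. [folklore] -/
theorem gLow_smul_kA (D : ℕ) (j : ℤ) : gLow • kA D j = ![32 * j - D, (D : ℤ) - 64 * j, j] := by
  rw [smul_def32]
  have hcq : cq32 gLow = 1 := by
    have := thirtytwo_mul_cq32 gLow
    rw [show (((gLow : Gamma0Plus 32) : SL(2, ℤ)) 1 0 : ℤ) = 32 from rfl] at this
    omega
  rw [hcq, show (((gLow : Gamma0Plus 32) : SL(2, ℤ)) 1 1 : ℤ) = 1 from rfl,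
    show (((gLow : Gamma0Plus 32) : SL(2, ℤ)) 0 1 : ℤ) = 0 from rfl,
    show (((gLow : Gamma0Plus 32) : SL(2, ℤ)) 0 0 : ℤ) = 1 from rfl]
  funext i
  fin_cases i <;> simp [actSharp32, kA] <;> ring

/-- `Δ(kA D j) = D²`. [folklore] -/
theorem discK_kA (D : ℕ) (j : ℤ) : discK (kA D j) = (D : ℤ) ^ 2 := by
  simp [discK, kA]

/-- **The orbit datum of the class of `D xy + j y²`** (`D` odd): `u(⟦kA D j⟧) = -{∞, -j/D}_φ/(2πi)`
— at the representative `g • kA = (32j - D, D - 64j, j)` the root cusps are `g∞ = 1/32` and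
`g(-j/D) = j/(32j - D)`, and by the Manin relation `{∞, g(-j/D)} = {∞, g∞} + {∞, -j/D}`.
[cite: Shintani1975, §2, Lemma 2.7 (ii)] [cite: Manin1972, Thm. 1.6] -/
theorem orbDatum_kA (f : CuspForm (Gamma0 32) 2) {D : ℕ} (hD : Odd D) (j : ℤ) :
    orbDatum f (Quotient.mk'' (kA D j) : orbitRel.Quotient (Gamma0Plus 32) (Fin 3 → ℤ)) =
      -modularSymbol f ((-j : ℚ) / D) / (2 * Real.pi * I) := by
  set ω : orbitRel.Quotient (Gamma0Plus 32) (Fin 3 → ℤ) := Quotient.mk'' (kA D j) with hω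
  have hD0 : (D : ℤ) ≠ 0 := by obtain ⟨m, hm⟩ := hD; omega
  have hDpos : (0 : ℤ) < D := by obtain ⟨m, hm⟩ := hD; omega
  have h32 : (32 * j - D : ℤ) ≠ 0 := by obtain ⟨m, hm⟩ := hD; omega
  -- the representative `k = g • kA` lies in the orbit of `ω.out`
  have hout : ω.out ∈ MulAction.orbit (Gamma0Plus 32) (kA D j) := by
    have h := Quotient.out_eq' ω
    rw [hω] at h ⊢
    exact Quotient.exact' h
  have hk : gLow • kA D j ∈ MulAction.orbit (Gamma0Plus 32) ω.out := by
    rw [MulAction.orbit_eq_iff.mpr hout]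
    exact MulAction.mem_orbit _ _
  have hΔ : discK (gLow • kA D j) = (D : ℤ) ^ 2 := by
    rw [gLow_smul_kA]; simp [discK]; ring
  have hx : latSharp32 (gLow • kA D j) = !₂[(32 * (32 * j - D) : ℝ), ((D : ℤ) - 64 * j : ℤ), (j : ℝ)] := by
    rw [gLow_smul_kA]; ext i; fin_cases i <;> simp [latSharp32]
  have hx0 : latSharp32 (gLow • kA D j) 0 ≠ 0 := by
    rw [hx]; simp
    exact_mod_cast h32
  have hq₁ : (((1 : ℚ) / 32 : ℚ) : ℝ) = (-latSharp32 (gLow • kA D j) 1 - (D : ℤ)) / (2 * latSharp32 (gLow • kA D j) 0) := by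
    rw [hx]; simp
    have : (32 * j - D : ℝ) ≠ 0 := by exact_mod_cast h32
    field_simp
    ring
  have hq₂ : (((j : ℚ) / (32 * j - D) : ℚ) : ℝ) = (-latSharp32 (gLow • kA D j) 1 + (D : ℤ)) / (2 * latSharp32 (gLow • kA D j) 0) := by
    rw [hx]; simp
    have : (32 * j - D : ℝ) ≠ 0 := by exact_mod_cast h32
    field_simp
    ring
  rw [orbDatum_eq_of_rep f ω hk hDpos hΔ hx0 hq₁ hq₂]
  -- Manin: `{∞, g(-j/D)} = {∞, g∞} + {∞, -j/D}` and `{∞, g∞} = {∞, 1/32}`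
  have hγ : gamma0Gen ∈ Gamma0 32 := gamma0Gen_mem
  have hr : (((gamma0Gen 1 0 : ℤ) : ℚ)) * ((-j : ℚ) / D) + ((gamma0Gen 1 1 : ℤ) : ℚ) ≠ 0 := by
    rw [gamma0Gen_10, gamma0Gen_11]
    have hDQ : (D : ℚ) ≠ 0 := by exact_mod_cast hD0
    intro h
    field_simp at h
    push_cast at h
    have : (32 * j - D : ℚ) = 0 := by linarith
    exact h32 (by exact_mod_cast this)
  have hManin := modularSymbol_gamma0_smul_holds f ⟨gamma0Gen, hγ⟩ ((-j : ℚ) / D) hr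
  simp only [gamma0Gen_00, gamma0Gen_01, gamma0Gen_10, gamma0Gen_11, Int.cast_one, Int.cast_zero, one_mul,
    add_zero, Int.cast_ofNat] at hManin
  have hcusp : cuspSymbol f ⟨gamma0Gen, hγ⟩ = modularSymbol f ((1 : ℚ) / 32) := by
    rw [cuspSymbol, if_neg (by rw [gamma0Gen_10]; norm_num)]
    congr 1
  have hpt : ((-j : ℚ) / D) / (32 * ((-j : ℚ) / D) + 1) = (j : ℚ) / (32 * j - D) := by
    have hDQ : (D : ℚ) ≠ 0 := by exact_mod_cast hD0
    have h32Q : (32 * j - D : ℚ) ≠ 0 := by exact_mod_cast h32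
    have h32Q' : (32 * ((-j : ℚ) / D) + 1) ≠ 0 := by
      intro h
      field_simp at h
      apply h32Q; linarith
    rw [div_eq_div_iff h32Q' h32Q]
    field_simp
    ring
  rw [hpt] at hManin
  rw [hManin, hcusp]
  ring

/-- `g • (-kA) = (D - 32j, 64j - D, -j)`. [folklore] -/
theorem gLow_smul_neg_kA (D : ℕ) (j : ℤ) : gLow • (-kA D j) = ![(D : ℤ) - 32 * j, 64 * j - D, -j] := by
  rw [smul_def32]
  have hcq : cq32 gLow = 1 := by
    have := thirtytwo_mul_cq32 gLow
    rw [show (((gLow : Gamma0Plus 32) : SL(2, ℤ)) 1 0 : ℤ) = 32 from rfl] at this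
    omega
  rw [hcq, show (((gLow : Gamma0Plus 32) : SL(2, ℤ)) 1 1 : ℤ) = 1 from rfl,
    show (((gLow : Gamma0Plus 32) : SL(2, ℤ)) 0 1 : ℤ) = 0 from rfl,
    show (((gLow : Gamma0Plus 32) : SL(2, ℤ)) 0 0 : ℤ) = 1 from rfl]
  funext i
  fin_cases i <;> simp [actSharp32, kA] <;> ring

/-- **The orbit datum of the class of `-(D xy + j y²)`**: `u(⟦-kA D j⟧) = +{∞, -j/D}_φ/(2πi)`
(the roots are swapped). [cite: Shintani1975, §2, Lemma 2.7 (ii)] [cite: Manin1972, Thm. 1.6] -/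
theorem orbDatum_neg_kA (f : CuspForm (Gamma0 32) 2) {D : ℕ} (hD : Odd D) (j : ℤ) :
    orbDatum f (Quotient.mk'' (-kA D j) : orbitRel.Quotient (Gamma0Plus 32) (Fin 3 → ℤ)) =
      modularSymbol f ((-j : ℚ) / D) / (2 * Real.pi * I) := by
  set ω : orbitRel.Quotient (Gamma0Plus 32) (Fin 3 → ℤ) := Quotient.mk'' (-kA D j) with hω
  have hD0 : (D : ℤ) ≠ 0 := by obtain ⟨m, hm⟩ := hD; omega
  have hDpos : (0 : ℤ) < D := by obtain ⟨m, hm⟩ := hD; omega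
  have h32 : (32 * j - D : ℤ) ≠ 0 := by obtain ⟨m, hm⟩ := hD; omega
  have h32' : ((D : ℤ) - 32 * j : ℤ) ≠ 0 := by obtain ⟨m, hm⟩ := hD; omega
  have hout : ω.out ∈ MulAction.orbit (Gamma0Plus 32) (-kA D j) := by
    have h := Quotient.out_eq' ω
    rw [hω] at h ⊢
    exact Quotient.exact' h
  have hk : gLow • (-kA D j) ∈ MulAction.orbit (Gamma0Plus 32) ω.out := by
    rw [MulAction.orbit_eq_iff.mpr hout]
    exact MulAction.mem_orbit _ _
  have hΔ : discK (gLow • (-kA D j)) = (D : ℤ) ^ 2 := by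
    rw [gLow_smul_neg_kA]; simp [discK]; ring
  have hx : latSharp32 (gLow • (-kA D j)) = !₂[(32 * (D - 32 * j) : ℝ), (64 * j - (D : ℤ) : ℤ), ((-j : ℤ) : ℝ)] := by
    rw [gLow_smul_neg_kA]; ext i; fin_cases i <;> simp [latSharp32]
  have hx0 : latSharp32 (gLow • (-kA D j)) 0 ≠ 0 := by
    rw [hx]; simp
    exact_mod_cast h32'
  have hq₁ : (((-j : ℚ) / (D - 32 * j) : ℚ) : ℝ) =
      (-latSharp32 (gLow • (-kA D j)) 1 - (D : ℤ)) / (2 * latSharp32 (gLow • (-kA D j)) 0) := by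
    rw [hx]; simp
    have : ((D : ℝ) - 32 * j : ℝ) ≠ 0 := by exact_mod_cast h32'
    field_simp
    ring
  have hq₂ : (((1 : ℚ) / 32 : ℚ) : ℝ) =
      (-latSharp32 (gLow • (-kA D j)) 1 + (D : ℤ)) / (2 * latSharp32 (gLow • (-kA D j)) 0) := by
    rw [hx]; simp
    have : ((D : ℝ) - 32 * j : ℝ) ≠ 0 := by exact_mod_cast h32'
    field_simp
    ring
  rw [orbDatum_eq_of_rep f ω hk hDpos hΔ hx0 hq₁ hq₂]
  have hγ : gamma0Gen ∈ Gamma0 32 := gamma0Gen_mem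
  have hr : (((gamma0Gen 1 0 : ℤ) : ℚ)) * ((-j : ℚ) / D) + ((gamma0Gen 1 1 : ℤ) : ℚ) ≠ 0 := by
    rw [gamma0Gen_10, gamma0Gen_11]
    have hDQ : (D : ℚ) ≠ 0 := by exact_mod_cast hD0
    intro h
    field_simp at h
    push_cast at h
    have : (32 * j - D : ℚ) = 0 := by linarith
    exact h32 (by exact_mod_cast this)
  have hManin := modularSymbol_gamma0_smul_holds f ⟨gamma0Gen, hγ⟩ ((-j : ℚ) / D) hr
  simp only [gamma0Gen_00, gamma0Gen_01, gamma0Gen_10, gamma0Gen_11, Int.cast_one, Int.cast_zero, one_mul,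
    add_zero, Int.cast_ofNat] at hManin
  have hcusp : cuspSymbol f ⟨gamma0Gen, hγ⟩ = modularSymbol f ((1 : ℚ) / 32) := by
    rw [cuspSymbol, if_neg (by rw [gamma0Gen_10]; norm_num)]
    congr 1
  have hpt : ((-j : ℚ) / D) / (32 * ((-j : ℚ) / D) + 1) = (-j : ℚ) / (D - 32 * j) := by
    have hDQ : (D : ℚ) ≠ 0 := by exact_mod_cast hD0
    have h32Q : ((D : ℚ) - 32 * j : ℚ) ≠ 0 := by exact_mod_cast h32'
    have h32Q' : (32 * ((-j : ℚ) / D) + 1) ≠ 0 := by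
      intro h
      field_simp at h
      apply h32Q; linarith
    rw [div_eq_div_iff h32Q' h32Q]
    field_simp
    ring
  rw [hpt] at hManin
  rw [hManin, hcusp]
  ring

end Literature.NumberTheory.EllipticCurves.Shintani

noncomputable section

open scoped MatrixGroups ModularForm
open Complex Real MeasureTheory Set Filter CongruenceSubgroup ModularGroup MulAction
open UpperHalfPlane hiding I
open Literature.NumberTheory.EllipticCurves.ModularForms
open Literature.NumberTheory.QuadraticFields (jacobiChar jacobiChar_apply)

namespace Literature.NumberTheory.EllipticCurves.Shintani

/-! ### Elements of `Γ₀(32)⁺` with prescribed bottom row -/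

/-- For coprime `(s, t)` with `32 ∣ t` and `s ≡ 1 (mod 4)` there is `g ∈ Γ₀(32)⁺` with bottom row
`(-t, s)`. [folklore] -/
theorem exists_gamma0Plus_bottom_row {s t : ℤ} (hcop : IsCoprime s t) (h32 : (32 : ℤ) ∣ t)
    (hs4 : s % 4 = 1) :
    ∃ g : Gamma0Plus 32, ((g : SL(2, ℤ)) 1 0 : ℤ) = -t ∧ ((g : SL(2, ℤ)) 1 1 : ℤ) = s := by
  obtain ⟨p, q, hpq⟩ := hcop
  set γ : SL(2, ℤ) := ⟨!![p, q; -t, s], by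
    rw [Matrix.det_fin_two_of]; linear_combination hpq⟩ with hγ
  have h10 : (γ 1 0 : ℤ) = -t := rfl
  have h11 : (γ 1 1 : ℤ) = s := rfl
  have h00 : (γ 0 0 : ℤ) = p := rfl
  have hmem : γ ∈ Gamma0Plus 32 := by
    refine Subgroup.mem_inf.mpr ⟨?_, ?_⟩
    · rw [Gamma0_mem, h10]
      exact (ZMod.intCast_zmod_eq_zero_iff_dvd _ 32).mpr (dvd_neg.mpr h32)
    · rw [Gamma1_mem, h00, h11, h10]
      have h4t : (4 : ℤ) ∣ t := dvd_trans (by norm_num) h32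
      have hp4 : p % 4 = 1 := by
        obtain ⟨u, hu⟩ := h4t
        have hps : p * s % 4 = 1 := by
          have e : p * s = 1 + 4 * (-(q * u)) := by rw [hu] at hpq; linear_combination hpq
          rw [e, Int.add_mul_emod_self_left]
          norm_num
        have := Int.mul_emod p s 4
        rw [hs4] at this
        omega
      refine ⟨?_, ?_, ?_⟩
      · rw [← ZMod.intCast_mod p 4, show p % ((4 : ℕ) : ℤ) = 1 by exact_mod_cast hp4]; rfl
      · rw [← ZMod.intCast_mod s 4, show s % ((4 : ℕ) : ℤ) = 1 by exact_mod_cast hs4]; rfl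
      · rw [Int.cast_neg, neg_eq_zero]
        exact (ZMod.intCast_zmod_eq_zero_iff_dvd _ 4).mpr h4t
  exact ⟨⟨γ, hmem⟩, h10, h11⟩

/-- **The leading coefficient of `g • k` is `Q_k(g₁₁, -g₁₀)/32`**:
`32 (g • k)₀ = 32 k₀ g₁₁² - k₁ g₁₁ g₁₀ + k₂ g₁₀²`. [folklore] -/
theorem smul_apply_zero (g : Gamma0Plus 32) (k : Fin 3 → ℤ) :
    32 * (g • k) 0 = 32 * k 0 * ((g : SL(2, ℤ)) 1 1 : ℤ) ^ 2 -
      k 1 * ((g : SL(2, ℤ)) 1 1 : ℤ) * ((g : SL(2, ℤ)) 1 0 : ℤ) + k 2 * ((g : SL(2, ℤ)) 1 0 : ℤ) ^ 2 := by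
  rw [smul_def32]
  simp only [actSharp32, Matrix.cons_val_zero]
  have h := thirtytwo_mul_cq32 g
  rw [← h]
  ring

/-- The second coordinate of `g • k`. [folklore] -/
theorem smul_apply_one (g : Gamma0Plus 32) (k : Fin 3 → ℤ) :
    (g • k) 1 = 64 * k 0 * ((g : SL(2, ℤ)) 1 1 : ℤ) * (-((g : SL(2, ℤ)) 0 1 : ℤ)) +
      k 1 * (((g : SL(2, ℤ)) 1 1 : ℤ) * ((g : SL(2, ℤ)) 0 0 : ℤ) + 32 * (-((g : SL(2, ℤ)) 0 1 : ℤ)) * (-cq32 g)) +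
      64 * k 2 * (-cq32 g) * ((g : SL(2, ℤ)) 0 0 : ℤ) := by
  rw [smul_def32]
  simp [actSharp32]

/-- The third coordinate of `g • k`: `(g • k)₂ = 32 k₀ b² - k₁ b a + k₂ a²` (`a = g₀₀`, `b = g₀₁`).
[folklore] -/
theorem smul_apply_two (g : Gamma0Plus 32) (k : Fin 3 → ℤ) :
    (g • k) 2 = 32 * k 0 * ((g : SL(2, ℤ)) 0 1 : ℤ) ^ 2 - k 1 * ((g : SL(2, ℤ)) 0 1 : ℤ) * ((g : SL(2, ℤ)) 0 0 : ℤ) +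
      k 2 * ((g : SL(2, ℤ)) 0 0 : ℤ) ^ 2 := by
  rw [smul_def32]
  simp [actSharp32]
  ring

/-! ### An isotropic primitive direction with `32 ∣ t` -/

/-- For `k₁² - 128 k₀ k₂ = D²` with `D` odd and `k₀ ≠ 0` there are coprime `s, t` with `32 ∣ t`,
`s ≡ 1 (mod 4)` and `Q_k(s, t) = 32k₀s² + k₁st + k₂t² = 0`. [folklore] -/
theorem exists_isotropic_dir {k : Fin 3 → ℤ} {D : ℤ} (hD : Odd D) (hΔ : discK k = D ^ 2) (hk0 : k 0 ≠ 0) :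
    ∃ s t : ℤ, IsCoprime s t ∧ (32 : ℤ) ∣ t ∧ s % 4 = 1 ∧ 32 * k 0 * s ^ 2 + k 1 * s * t + k 2 * t ^ 2 = 0 := by
  -- `k₁` is odd, so exactly one of `k₁ ∓ D` is `≡ 2 (mod 4)`; call it `e = k₁ - σ D`
  have hk1 : Odd (k 1) := by
    have hsq : Odd (k 1 * k 1) := by
      have e : k 1 * k 1 = discK k + 128 * k 0 * k 2 := by rw [discK]; ring
      rw [e, hΔ]; exact (hD.pow).add_even ⟨64 * k 0 * k 2, by ring⟩
    exact Int.Odd.of_mul_left hsq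
  obtain ⟨σ, hσ, he2⟩ : ∃ σ : ℤ, σ ^ 2 = 1 ∧ (k 1 - σ * D) % 4 = 2 := by
    have h1 : k 1 % 2 = 1 := Int.odd_iff.mp hk1
    have h2 : D % 2 = 1 := Int.odd_iff.mp hD
    by_cases h : (k 1 - D) % 4 = 2
    · exact ⟨1, by norm_num, by simpa using h⟩
    · refine ⟨-1, by norm_num, ?_⟩
      have : (k 1 - D) % 4 = 0 := by omega
      omega
  set e : ℤ := k 1 - σ * D with he
  set g : ℕ := Int.gcd e (64 * k 0) with hg
  have hgpos : 0 < g := by rw [hg]; exact Int.gcd_pos_iff.mpr (Or.inr (by omega))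
  have hg0 : (g : ℤ) ≠ 0 := by exact_mod_cast hgpos.ne'
  have hge : (g : ℤ) ∣ e := Int.gcd_dvd_left _ _
  have hgk : (g : ℤ) ∣ 64 * k 0 := Int.gcd_dvd_right _ _
  -- `2 ∣ g`, `4 ∤ g`
  have h2e : (2 : ℤ) ∣ e := by omega
  have h4e : ¬ (4 : ℤ) ∣ e := by omega
  have h2g : (2 : ℤ) ∣ g := by
    rw [hg]; exact Int.dvd_coe_gcd h2e ⟨32 * k 0, by ring⟩
  have h4g : ¬ (4 : ℤ) ∣ g := fun h ↦ h4e (h.trans hge)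
  obtain ⟨g', hg'⟩ := h2g
  have hg'odd : Odd g' := by
    by_contra h
    rw [Int.not_odd_iff_even] at h
    obtain ⟨r, hr⟩ := h
    exact h4g ⟨r, by rw [hg', hr]; ring⟩
  -- the direction `(s₀, t₀) = (-e/g, 64k₀/g)`
  set s₀ : ℤ := -(e / g) with hs₀
  set t₀ : ℤ := 64 * k 0 / g with ht₀
  have hes : e = g * (e / g) := (Int.mul_ediv_cancel' hge).symm
  have hkt : 64 * k 0 = g * t₀ := (Int.mul_ediv_cancel' hgk).symm
  have hcop₀ : IsCoprime s₀ t₀ := by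
    rw [hs₀, ht₀, hg]
    exact (Int.isCoprime_iff_gcd_eq_one.mpr (Int.gcd_div_gcd_div_gcd hgpos)).neg_left
  -- `e/g` is odd and `32 ∣ t₀`
  have hsodd : Odd (e / g) := by
    by_contra h
    rw [Int.not_odd_iff_even] at h
    obtain ⟨r, hr⟩ := h
    apply h4e
    refine ⟨g' * r, ?_⟩
    rw [hes, hr, hg']; ring
  have h32t : (32 : ℤ) ∣ t₀ := by
    -- `g' ∣ 32 k₀` with `g'` odd gives `g' ∣ k₀`
    have hg't : g' * t₀ = 32 * k 0 := by
      have := hkt; rw [hg'] at this; linarith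
    have hg'dvd : (g' : ℤ) ∣ 32 * k 0 := ⟨t₀, hg't.symm⟩
    have hcop2 : IsCoprime (g' : ℤ) 32 := by
      have : IsCoprime (g' : ℤ) 2 := by
        obtain ⟨r, hr⟩ := hg'odd
        exact ⟨1, -r, by rw [hr]; ring⟩
      simpa using this.pow_right (n := 5)
    have hg'k : (g' : ℤ) ∣ k 0 := hcop2.dvd_of_dvd_mul_left hg'dvd
    obtain ⟨u, hu⟩ := hg'k
    have hg'0 : (g' : ℤ) ≠ 0 := by rintro h0; rw [h0, mul_zero] at hg'; exact hg0 hg'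
    refine ⟨u, ?_⟩
    have : g' * t₀ = g' * (32 * u) := by rw [hg't, hu]; ring
    exact mul_left_cancel₀ hg'0 this
  -- isotropy: `64 k₀ s₀ + e t₀ = 0`, whence `128 k₀ Q_k(s₀, t₀) = (64k₀s₀ + (k₁ - σD)t₀)(64k₀s₀ + (k₁ + σD)t₀) = 0`
  have hiso : 64 * k 0 * s₀ + e * t₀ = 0 := by
    have h1 : 64 * k 0 * s₀ = -((g : ℤ) * t₀ * (e / g)) := by rw [hs₀, hkt]; ring
    have h2 : e * t₀ = (g : ℤ) * (e / g) * t₀ := by conv_lhs => rw [hes]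
    rw [h1, h2]; ring
  have hQ : 32 * k 0 * s₀ ^ 2 + k 1 * s₀ * t₀ + k 2 * t₀ ^ 2 = 0 := by
    have hfac : 128 * k 0 * (32 * k 0 * s₀ ^ 2 + k 1 * s₀ * t₀ + k 2 * t₀ ^ 2) =
        (64 * k 0 * s₀ + e * t₀) * (64 * k 0 * s₀ + (k 1 + σ * D) * t₀) := by
      have hD2 : discK k = D ^ 2 := hΔ
      rw [discK] at hD2
      rw [he]
      have : (k 1) ^ 2 - (σ * D) ^ 2 = 128 * k 0 * k 2 := by
        rw [mul_pow, hσ, one_mul]; linarith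
      linear_combination (-(t₀ ^ 2)) * this
    rw [hiso, zero_mul] at hfac
    rcases mul_eq_zero.mp hfac with h | h
    · omega
    · exact h
  -- fix the sign so that `s ≡ 1 (mod 4)`
  have hs₀odd : Odd s₀ := by rw [hs₀]; exact hsodd.neg
  rcases Int.odd_iff.mp hs₀odd |> fun h ↦ (show s₀ % 4 = 1 ∨ s₀ % 4 = 3 by omega) with h1 | h3
  · exact ⟨s₀, t₀, hcop₀, h32t, h1, hQ⟩
  · refine ⟨-s₀, -t₀, hcop₀.neg_neg, dvd_neg.mpr h32t, by omega, ?_⟩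
    linear_combination hQ

/-! ### Normal forms -/

/-- The translation `T^n = (1 n; 0 1) ∈ Γ₀(32)⁺`. [folklore] -/
def transl (n : ℤ) : Gamma0Plus 32 :=
  ⟨⟨!![1, n; 0, 1], by norm_num [Matrix.det_fin_two_of]⟩, by
    refine Subgroup.mem_inf.mpr ⟨?_, ?_⟩
    · rw [Gamma0_mem]; rfl
    · rw [Gamma1_mem]; exact ⟨rfl, rfl, rfl⟩⟩

/-- `T^n • (0, k₁, k₂) = (0, k₁, k₂ - n k₁)`. [folklore] -/
theorem transl_smul (n k₁ k₂ : ℤ) : transl n • (![0, k₁, k₂] : Fin 3 → ℤ) = ![0, k₁, k₂ - n * k₁] := by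
  rw [smul_def32]
  have hcq : cq32 (transl n) = 0 := by
    have := thirtytwo_mul_cq32 (transl n)
    rw [show (((transl n : Gamma0Plus 32) : SL(2, ℤ)) 1 0 : ℤ) = 0 from rfl] at this
    omega
  rw [hcq, show (((transl n : Gamma0Plus 32) : SL(2, ℤ)) 1 1 : ℤ) = 1 from rfl,
    show (((transl n : Gamma0Plus 32) : SL(2, ℤ)) 0 1 : ℤ) = n from rfl,
    show (((transl n : Gamma0Plus 32) : SL(2, ℤ)) 0 0 : ℤ) = 1 from rfl]
  funext i
  fin_cases i <;> simp [actSharp32]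
  ring

/-- **Classification**: every `k` with `Δ(k) = D²` (`D > 0` odd) is `Γ₀(32)⁺`-equivalent to
`kA D j` or to `-kA D j` for some `0 ≤ j < D`. [cite: Shintani1975, §3] -/
theorem exists_smul_eq_kA_or_neg {k : Fin 3 → ℤ} {D : ℕ} (hD : Odd D) (hΔ : discK k = (D : ℤ) ^ 2) :
    ∃ (γ : Gamma0Plus 32) (j : ℤ), 0 ≤ j ∧ j < D ∧ (γ • k = kA D j ∨ γ • k = -kA D j) := by
  have hDZ : Odd (D : ℤ) := by exact_mod_cast hD
  have hD0 : (0 : ℤ) < D := by obtain ⟨m, hm⟩ := hD; omega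
  -- Step 1: an element `g` with `(g • k)₀ = 0`
  obtain ⟨g, hg0⟩ : ∃ g : Gamma0Plus 32, (g • k) 0 = 0 := by
    by_cases hk0 : k 0 = 0
    · exact ⟨1, by rw [one_smul]; exact hk0⟩
    · obtain ⟨s, t, hcop, h32, hs4, hQ⟩ := exists_isotropic_dir hDZ hΔ hk0
      obtain ⟨g, h10, h11⟩ := exists_gamma0Plus_bottom_row hcop h32 hs4
      refine ⟨g, ?_⟩
      have h := smul_apply_zero g k
      rw [h10, h11] at h
      have : 32 * (g • k) 0 = 0 := by rw [h]; linear_combination hQ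
      omega
  -- Step 2: `(g • k)₁ = ± D`
  set k' := g • k with hk'
  have hΔ' : discK k' = (D : ℤ) ^ 2 := by
    have h := disc_latSharp32_smul g k
    rw [disc_latSharp32_eq_discK, disc_latSharp32_eq_discK] at h
    have : discK k' = discK k := by exact_mod_cast h
    rw [this, hΔ]
  have hk1 : k' 1 = D ∨ k' 1 = -(D : ℤ) := by
    have : k' 1 ^ 2 = (D : ℤ) ^ 2 := by
      rw [← hΔ', discK, hg0]; ring
    exact sq_eq_sq_iff_eq_or_eq_neg.mp this
  -- Step 3: normalise the last coordinate by a translation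
  have hk'vec : k' = ![0, k' 1, k' 2] := by
    funext i; fin_cases i
    · exact hg0
    · rfl
    · rfl
  rcases hk1 with h1 | h1
  · -- `k' = (0, D, k₂')`: translate by `n = k₂' / D`
    set n : ℤ := k' 2 / D with hn
    have hmod : k' 2 - n * (D : ℤ) = k' 2 % D := by rw [hn, Int.emod_def]; ring
    refine ⟨transl n * g, k' 2 % D, Int.emod_nonneg _ hD0.ne', Int.emod_lt_of_pos _ hD0, Or.inl ?_⟩
    rw [mul_smul, ← hk', hk'vec, h1, transl_smul, hmod]
    rfl
  · -- `k' = (0, -D, k₂')`: `-kA D j` with `j = (-k₂') mod D`, translating by `n = (-k₂') / D`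
    set j : ℤ := (-k' 2) % D with hj
    set n : ℤ := (-k' 2) / D with hn
    have hmod : k' 2 - n * (-(D : ℤ)) = -j := by rw [hn, hj, Int.emod_def]; ring
    refine ⟨transl n * g, j, Int.emod_nonneg _ hD0.ne', Int.emod_lt_of_pos _ hD0, Or.inr ?_⟩
    rw [mul_smul, ← hk', hk'vec, h1, transl_smul, hmod]
    funext i; fin_cases i <;> simp [kA]

/-! ### The weights and the distinctness of the normal forms -/

/-- **`χ_{D*}(kA D j) = (j/D)`** (`D` odd square-free): every `p ∣ D` divides `k₀ = 0`, so the
local symbol is `(k₂/p) = (j/p)`. [folklore] -/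
theorem kohnenWt_kA {D : ℕ} (hsq : Squarefree D) (j : ℤ) : kohnenWt D (kA D j) = jacobiSym j D := by
  unfold kohnenWt
  conv_rhs => rw [← Nat.prod_primeFactors_of_squarefree hsq]
  rw [jacobiSym_prod_primes _ _ fun p hp ↦ Nat.prime_of_mem_primeFactors hp]
  refine Finset.prod_congr rfl fun p hp ↦ ?_
  have hpD : (p : ℤ) ∣ (D : ℤ) := by exact_mod_cast Nat.dvd_of_mem_primeFactors hp
  unfold kohnenSym
  rw [if_pos (by rw [discK_kA]; exact dvd_pow hpD two_ne_zero), if_pos (by simp [kA])]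
  simp [kA]

/-- The action is additive: `γ • (-k) = -(γ • k)`. [folklore] -/
theorem smul_neg32 (γ : Gamma0Plus 32) (k : Fin 3 → ℤ) : γ • (-k) = -(γ • k) := by
  rw [smul_def32, smul_def32]
  funext i
  fin_cases i <;> simp [actSharp32] <;> ring

/-- If `γ • kA D j' = kA D j`-type with vanishing leading coefficient, then `γ₁₀ = 0` and
`γ₀₀ = γ₁₁ = 1`. [folklore] -/
theorem entries_of_smul_kA_zero {D : ℕ} (hD : Odd D) {j' : ℤ} {γ : Gamma0Plus 32}
    (h0 : (γ • kA D j') 0 = 0) :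
    ((γ : SL(2, ℤ)) 1 0 : ℤ) = 0 ∧ ((γ : SL(2, ℤ)) 0 0 : ℤ) = 1 ∧ ((γ : SL(2, ℤ)) 1 1 : ℤ) = 1 := by
  set a : ℤ := (γ : SL(2, ℤ)) 0 0 with ha
  set b : ℤ := (γ : SL(2, ℤ)) 0 1 with hb
  set c : ℤ := (γ : SL(2, ℤ)) 1 0 with hc
  set s : ℤ := (γ : SL(2, ℤ)) 1 1 with hs
  have hdet : a * s - b * c = 1 := det_eq_one' (γ : SL(2, ℤ))
  have h32 : (32 : ℤ) ∣ c := by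
    have := Gamma0_mem.mp (Gamma0Plus_le γ.2)
    exact (ZMod.intCast_zmod_eq_zero_iff_dvd _ 32).mp this
  have hs4 : s % 4 = 1 := by
    have h1 := ((Gamma1_mem _ _).mp (Subgroup.mem_inf.mp γ.2).2).2.1
    rw [← hs] at h1
    have hmod : s ≡ 1 [ZMOD (4 : ℕ)] := (ZMod.intCast_eq_intCast_iff s 1 4).mp (by rw [Int.cast_one]; exact h1)
    unfold Int.ModEq at hmod
    omega
  have ha4 : a % 4 = 1 := by
    have h1 := ((Gamma1_mem _ _).mp (Subgroup.mem_inf.mp γ.2).2).1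
    rw [← ha] at h1
    have hmod : a ≡ 1 [ZMOD (4 : ℕ)] := (ZMod.intCast_eq_intCast_iff a 1 4).mp (by rw [Int.cast_one]; exact h1)
    unfold Int.ModEq at hmod
    omega
  have hz := smul_apply_zero γ (kA D j')
  rw [h0, ← hc, ← hs] at hz
  simp only [kA_apply_zero, kA_apply_one, kA_apply_two, mul_zero, zero_mul, zero_sub] at hz
  -- `c (j' c - D s) = 0`
  have hprod : c * (j' * c - D * s) = 0 := by linear_combination -hz
  have hc0 : c = 0 := by
    rcases mul_eq_zero.mp hprod with h | h
    · exact h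
    · exfalso
      -- `32 ∣ D s` with `D` odd forces `s` even
      obtain ⟨c', hc'⟩ := h32
      have hDs : (32 : ℤ) ∣ D * s := ⟨j' * c', by rw [hc'] at h; linear_combination -h⟩
      have hcop : IsCoprime (32 : ℤ) D := by
        have hD2 : IsCoprime (2 : ℤ) D := by
          obtain ⟨m, hm⟩ := hD
          exact ⟨-(m : ℤ), 1, by push_cast [hm]; ring⟩
        simpa using hD2.pow_left (m := 5)
      have := hcop.dvd_of_dvd_mul_left hDs
      omega
  have has : a * s = 1 := by rw [hc0, mul_zero, sub_zero] at hdet; exact hdet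
  have hs1 : s = 1 := by
    rcases Int.eq_one_or_neg_one_of_mul_eq_one' has with ⟨-, h⟩ | ⟨-, h⟩
    · exact h
    · omega
  have ha1 : a = 1 := by rw [hs1, mul_one] at has; exact has
  exact ⟨hc0, ha1, hs1⟩

/-- **`⟦kA D j⟧ = ⟦kA D j'⟧` forces `j ≡ j' (mod D)`.** [folklore] -/
theorem modEq_of_mk_kA_eq {D : ℕ} (hD : Odd D) {j j' : ℤ}
    (h : (Quotient.mk'' (kA D j) : orbitRel.Quotient (Gamma0Plus 32) (Fin 3 → ℤ)) = Quotient.mk'' (kA D j')) :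
    j ≡ j' [ZMOD D] := by
  obtain ⟨γ, hγ⟩ := Quotient.exact' h
  have hγ' : γ • kA D j' = kA D j := hγ
  obtain ⟨hc0, ha1, -⟩ := entries_of_smul_kA_zero hD (by rw [hγ']; rfl)
  have h2 := smul_apply_two γ (kA D j')
  rw [hγ', ha1] at h2
  simp only [kA_apply_zero, kA_apply_one, kA_apply_two, mul_zero, zero_mul, zero_sub, one_pow, mul_one] at h2
  exact Int.modEq_iff_dvd.mpr ⟨(γ : SL(2, ℤ)) 0 1, by linear_combination -h2⟩

/-- **`⟦kA D j⟧ ≠ ⟦-kA D j'⟧`.** [folklore] -/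
theorem mk_kA_ne_mk_neg {D : ℕ} (hD : Odd D) (j j' : ℤ) :
    (Quotient.mk'' (kA D j) : orbitRel.Quotient (Gamma0Plus 32) (Fin 3 → ℤ)) ≠ Quotient.mk'' (-kA D j') := by
  intro h
  obtain ⟨γ, hγ⟩ := Quotient.exact' h
  have hγ' : γ • (-kA D j') = kA D j := hγ
  rw [smul_neg32] at hγ'
  have h0 : (γ • kA D j') 0 = 0 := by
    have := congrFun hγ' 0
    rw [Pi.neg_apply, kA_apply_zero, neg_eq_zero] at this
    exact this
  obtain ⟨hc0, ha1, hs1⟩ := entries_of_smul_kA_zero hD h0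
  have h1 := smul_apply_one γ (kA D j')
  have hcq : cq32 γ = 0 := by
    have := thirtytwo_mul_cq32 γ
    rw [hc0] at this; omega
  rw [ha1, hs1, hcq] at h1
  simp only [kA_apply_zero, kA_apply_one, kA_apply_two, mul_zero, zero_mul, zero_add, neg_zero,
    add_zero, mul_one] at h1
  have := congrFun hγ' 1
  rw [Pi.neg_apply, kA_apply_one, h1] at this
  have hD0 : (0 : ℤ) < D := by obtain ⟨m, hm⟩ := hD; omega
  linarith

/-- **`⟦-kA D j⟧ = ⟦-kA D j'⟧` forces `j ≡ j' (mod D)`.** [folklore] -/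
theorem modEq_of_mk_neg_kA_eq {D : ℕ} (hD : Odd D) {j j' : ℤ}
    (h : (Quotient.mk'' (-kA D j) : orbitRel.Quotient (Gamma0Plus 32) (Fin 3 → ℤ)) = Quotient.mk'' (-kA D j')) :
    j ≡ j' [ZMOD D] := by
  obtain ⟨γ, hγ⟩ := Quotient.exact' h
  have hγ' : γ • (-kA D j') = -kA D j := hγ
  rw [smul_neg32, neg_inj] at hγ'
  exact modEq_of_mk_kA_eq hD (Quotient.sound ⟨γ, hγ'⟩ : (Quotient.mk'' (kA D j) :
    orbitRel.Quotient (Gamma0Plus 32) (Fin 3 → ℤ)) = Quotient.mk'' (kA D j'))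

/-! ### The weight along an orbit -/

/-- `χ_{D*}` is constant on `Γ₀(32)⁺`-orbits (`D` odd). [folklore] -/
theorem kohnenWt_eq_of_mem_orbit {D : ℕ} (hD : Odd D) {k k₀ : Fin 3 → ℤ}
    (hk : k ∈ MulAction.orbit (Gamma0Plus 32) k₀) : kohnenWt D k = kohnenWt D k₀ := by
  obtain ⟨g, rfl⟩ := hk
  show kohnenWt D (g • k₀) = kohnenWt D k₀
  rw [smul_def32]
  have h := invWeight32_kohnenWt hD (((g : Gamma0Plus 32) : SL(2, ℤ)) 1 1) (-((g : Gamma0Plus 32) : SL(2, ℤ)) 0 1)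
    (-cq32 g) (((g : Gamma0Plus 32) : SL(2, ℤ)) 0 0) (by
    have := det_eq_one' ((g : Gamma0Plus 32) : SL(2, ℤ))
    rw [← thirtytwo_mul_cq32 g] at this
    linear_combination this) k₀
  simp only at h
  exact_mod_cast h

/-- `Δ((⟦k⟧).out) = Δ(k)` and `χ((⟦k⟧).out) = χ(k)`. [folklore] -/
theorem out_mk_mem_orbit (k : Fin 3 → ℤ) :
    (Quotient.mk'' k : orbitRel.Quotient (Gamma0Plus 32) (Fin 3 → ℤ)).out ∈ MulAction.orbit (Gamma0Plus 32) k :=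
  Quotient.exact' (Quotient.out_eq' (Quotient.mk'' k : orbitRel.Quotient (Gamma0Plus 32) (Fin 3 → ℤ)))

/-! ### The class map and the diagonal sum -/

section Diagonal

variable (D : ℕ) [NeZero D]

/-- **The classes of discriminant `D²`**: `(a, false) ↦ ⟦kA D a⟧`, `(a, true) ↦ ⟦-kA D a⟧`. [folklore] -/
def classMap (x : ZMod D × Bool) : orbitRel.Quotient (Gamma0Plus 32) (Fin 3 → ℤ) :=
  if x.2 then Quotient.mk'' (-kA D (x.1.val : ℤ)) else Quotient.mk'' (kA D (x.1.val : ℤ))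

/-- Residues with equal integer lifts modulo `D` coincide. [folklore] -/
theorem zmod_eq_of_val_modEq {a b : ZMod D} (h : ((a.val : ℕ) : ℤ) ≡ ((b.val : ℕ) : ℤ) [ZMOD D]) : a = b := by
  apply ZMod.val_injective
  have ha : ((a.val : ℕ) : ℤ) % D = a.val := Int.emod_eq_of_lt (by positivity) (by exact_mod_cast ZMod.val_lt a)
  have hb : ((b.val : ℕ) : ℤ) % D = b.val := Int.emod_eq_of_lt (by positivity) (by exact_mod_cast ZMod.val_lt b)
  unfold Int.ModEq at h
  rw [ha, hb] at h
  exact_mod_cast h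

/-- **The class map is injective** (`D` odd). [folklore] -/
theorem classMap_injective (hD : Odd D) : Function.Injective (classMap D) := by
  rintro ⟨a, b⟩ ⟨a', b'⟩ h
  unfold classMap at h
  dsimp only at h
  cases b <;> cases b'
  · simp only [Bool.false_eq_true, if_false] at h
    exact Prod.ext (zmod_eq_of_val_modEq D (modEq_of_mk_kA_eq hD h)) rfl
  · simp only [Bool.false_eq_true, if_false, if_true] at h
    exact absurd h (mk_kA_ne_mk_neg hD _ _)
  · simp only [Bool.false_eq_true, if_false, if_true] at h
    exact absurd h.symm (mk_kA_ne_mk_neg hD _ _)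
  · simp only [if_true] at h
    exact Prod.ext (zmod_eq_of_val_modEq D (modEq_of_mk_neg_kA_eq hD h)) rfl

variable {D} in
/-- The integer lift of `j mod D` for `0 ≤ j < D` is `j`. [folklore] -/
theorem val_intCast_of_lt {j : ℤ} (h0 : 0 ≤ j) (hj : j < D) : (((j : ZMod D)).val : ℤ) = j := by
  rw [ZMod.val_intCast, Int.emod_eq_of_lt h0 hj]

/-- **The summand of `a_{G_D}(D)`**, extended by zero. [folklore] -/
def diagSummand (f : CuspForm (Gamma0 32) 2) (ω : orbitRel.Quotient (Gamma0Plus 32) (Fin 3 → ℤ)) : ℂ :=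
  if kohnenExp D ω = D then (kohnenWt D ω.out : ℂ) * orbDatum f ω else 0

/-- **Support of the summand**: a non-zero summand comes from a class of discriminant `D²`, hence
from the class map. [cite: Shintani1975, §3] -/
theorem support_diagSummand_subset (hsq : Squarefree D) (hD : Odd D) (f : CuspForm (Gamma0 32) 2) :
    Function.support (diagSummand D f) ⊆ Set.range (classMap D) := by
  intro ω hω
  rw [Function.mem_support, diagSummand] at hω
  have he : kohnenExp D ω = D := by by_contra h; exact hω (if_neg h)
  rw [if_pos he] at hω
  have hW : (kohnenWt D ω.out : ℂ) ≠ 0 := left_ne_zero_of_mul hω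
  have hu : orbDatum f ω ≠ 0 := right_ne_zero_of_mul hω
  have hpos : 0 < discK ω.out := by by_contra h; exact hu (orbDatum_of_not_pos f h)
  have hW' : kohnenWt D ω.out ≠ 0 := by exact_mod_cast hW
  have hdvd : (D : ℤ) ∣ discK ω.out := by by_contra h; exact hW' (kohnenWt_of_not_dvd hsq h)
  obtain ⟨m, hm⟩ := hdvd
  have hD0 : (0 : ℤ) < D := by exact_mod_cast Nat.pos_of_ne_zero (NeZero.ne D)
  have hm0 : 0 < m := by rw [hm] at hpos; exact pos_of_mul_pos_right hpos hD0.le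
  have hmD : m = D := by
    have h1 : kohnenExp D ω = (m.toNat : ℕ) := by
      rw [kohnenExp, hm, Int.mul_ediv_cancel_left _ hD0.ne']
    rw [he] at h1
    have : (D : ℤ) = m.toNat := by exact_mod_cast h1
    rw [Int.toNat_of_nonneg hm0.le] at this
    exact this.symm
  have hΔ : discK ω.out = (D : ℤ) ^ 2 := by rw [hm, hmD]; ring
  obtain ⟨γ, j, hj0, hjD, hγ⟩ := exists_smul_eq_kA_or_neg hD hΔ
  have hωeq : ω = Quotient.mk'' (γ • ω.out) := by
    rw [← Quotient.out_eq' ω]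
    exact (Quotient.sound ⟨γ, rfl⟩ : (Quotient.mk'' (γ • ω.out) :
      orbitRel.Quotient (Gamma0Plus 32) (Fin 3 → ℤ)) = Quotient.mk'' ω.out).symm |>.trans (by rw [Quotient.out_eq'])
  have hval : (((j : ZMod D)).val : ℤ) = j := val_intCast_of_lt hj0 hjD
  rcases hγ with h | h
  · refine ⟨((j : ZMod D), false), ?_⟩
    rw [classMap]; dsimp only; rw [if_neg Bool.false_ne_true, hval, ← h, ← hωeq]
  · refine ⟨((j : ZMod D), true), ?_⟩
    rw [classMap]; dsimp only; rw [if_pos rfl, hval, ← h, ← hωeq]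

/-- The exponent of the classes `⟦±kA D j⟧` is `D`. [folklore] -/
theorem kohnenExp_classMap (x : ZMod D × Bool) : kohnenExp D (classMap D x) = D := by
  have hD0 : (0 : ℤ) < D := by exact_mod_cast Nat.pos_of_ne_zero (NeZero.ne D)
  have key : ∀ k : Fin 3 → ℤ, discK k = (D : ℤ) ^ 2 →
      kohnenExp D (Quotient.mk'' k : orbitRel.Quotient (Gamma0Plus 32) (Fin 3 → ℤ)) = D := by
    intro k hk
    rw [kohnenExp, discK_eq_of_mem_orbit (out_mk_mem_orbit k), hk, sq, Int.mul_ediv_cancel_left _ hD0.ne']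
    rfl
  unfold classMap
  split_ifs
  · exact key _ (by rw [discK_neg, discK_kA])
  · exact key _ (discK_kA _ _)

/-- **The two summands of a pair agree**: `χ(kA) u(⟦kA⟧) = χ(-kA) u(⟦-kA⟧) = -(j/D) {∞,-j/D}/(2πi)`
(`D ≡ 3 (mod 4)` square-free). [folklore] -/
theorem diagSummand_classMap (hsq : Squarefree D) (hD3 : D % 4 = 3) (f : CuspForm (Gamma0 32) 2)
    (x : ZMod D × Bool) :
    diagSummand D f (classMap D x) =
      -(jacobiSym (x.1.val : ℤ) D : ℂ) * modularSymbol f ((-(x.1.val : ℤ) : ℚ) / D) / (2 * Real.pi * I) := by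
  have hD : Odd D := Nat.odd_iff.mpr (by omega)
  rw [diagSummand, if_pos (kohnenExp_classMap D x)]
  obtain ⟨a, b⟩ := x
  unfold classMap
  dsimp only
  cases b
  · simp only [Bool.false_eq_true, if_false]
    rw [kohnenWt_eq_of_mem_orbit hD (out_mk_mem_orbit _), kohnenWt_kA hsq, orbDatum_kA f hD]
    push_cast
    ring
  · simp only [if_true]
    rw [kohnenWt_eq_of_mem_orbit hD (out_mk_mem_orbit _), kohnenWt_neg_of_mod_four_eq_three hsq hD3,
      kohnenWt_kA hsq, orbDatum_neg_kA f hD]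
    push_cast
    ring

/-- **The twisted symbol sum, reflected**: `∑_{a mod D} (a/D) {∞, -a/D}_φ = -∑_a (a/D) {∞, a/D}_φ`
for `D ≡ 3 (mod 4)` (`(-1/D) = -1`). [folklore] -/
theorem sum_jacobiSym_mul_modularSymbol_neg (hD3 : D % 4 = 3) (f : CuspForm (Gamma0 32) 2) :
    ∑ a : ZMod D, (jacobiSym (a.val : ℤ) D : ℂ) * modularSymbol f ((-(a.val : ℤ) : ℚ) / D) =
      -twistedSymbolSum f (jacobiChar D) := by
  have hD : Odd D := Nat.odd_iff.mpr (by omega)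
  have hD0 : (D : ℤ) ≠ 0 := by exact_mod_cast NeZero.ne D
  rw [twistedSymbolSum, ← Finset.sum_neg_distrib]
  refine Fintype.sum_equiv (Equiv.neg (ZMod D)) _ _ fun a ↦ ?_
  simp only [Equiv.neg_apply]
  -- `χ(-a) = (-1/D)(a/D) = -(a/D)` and `{∞, (-a).val/D} = {∞, -a.val/D}`
  have hval : (((-a).val : ℕ) : ℤ) ≡ -((a.val : ℕ) : ℤ) [ZMOD D] := by
    rw [← ZMod.intCast_eq_intCast_iff]
    push_cast
    rw [ZMod.natCast_zmod_val, ZMod.natCast_zmod_val]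
  have hchar : jacobiChar D (-a) = -(jacobiSym (a.val : ℤ) D : ℂ) := by
    rw [jacobiChar_apply, jacobiSym.mod_left' hval, jacobiSym.neg _ hD, ZMod.χ₄_nat_three_mod_four hD3]
    push_cast
    ring
  obtain ⟨n, hn⟩ := (Int.modEq_iff_dvd.mp hval.symm)
  have hsymb : modularSymbol f ((((-a).val : ℕ) : ℚ) / D) = modularSymbol f ((-(a.val : ℤ) : ℚ) / D) := by
    have : ((((-a).val : ℕ) : ℚ) / D) = ((-(a.val : ℤ) : ℚ) / D) + (n : ℚ) := by
      have hDQ : (D : ℚ) ≠ 0 := by exact_mod_cast NeZero.ne D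
      field_simp
      have : (((-a).val : ℕ) : ℤ) = -((a.val : ℕ) : ℤ) + D * n := by linear_combination hn
      exact_mod_cast this
    rw [this, modularSymbol_add_intCast_holds f]
  rw [hchar, hsymb]
  push_cast
  ring

/-- **The diagonal coefficient of the normalized Kohnen-type lift** (`D ≡ 3 (mod 4)` square-free,
`φ` any weight-`2` cusp form on `Γ₀(32)`):
`a_{G_D}(D) = (πi)⁻¹ ∑_{a mod D} (a/D) {∞, a/D}_φ`. [cite: Shintani1975, §3] [cite: Tunnell1983Congruent, p. 329] -/
theorem qCoeffs_kohnenFamily_diag (hsq : Squarefree D) (hD3 : D % 4 = 3) (f : CuspForm (Gamma0 32) 2) :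
    qCoeffs (kohnenFamily D f) D = twistedSymbolSum f (jacobiChar D) / (Real.pi * I) := by
  have hD : Odd D := Nat.odd_iff.mpr (by omega)
  rw [qCoeffs_kohnenFamily D hsq hD f D, tsum_fiber_eq_tsum_ite]
  rw [show (fun ω : orbitRel.Quotient (Gamma0Plus 32) (Fin 3 → ℤ) ↦
      (if kohnenExp D ω = D then (kohnenWt D ω.out : ℂ) * orbDatum f ω else 0)) = diagSummand D f from rfl]
  rw [← (classMap_injective D hD).tsum_eq (support_diagSummand_subset D hsq hD f), tsum_fintype]
  simp_rw [diagSummand_classMap D hsq hD3 f]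
  rw [Fintype.sum_prod_type]
  simp only [Fintype.sum_bool]
  have hpi : (Real.pi : ℂ) ≠ 0 := by exact_mod_cast Real.pi_ne_zero
  have hπI : (Real.pi : ℂ) * I ≠ 0 := mul_ne_zero hpi Complex.I_ne_zero
  rw [show ∑ a : ZMod D, (-(jacobiSym (a.val : ℤ) D : ℂ) * modularSymbol f ((-(a.val : ℤ) : ℚ) / D) /
        (2 * Real.pi * I) +
      -(jacobiSym (a.val : ℤ) D : ℂ) * modularSymbol f ((-(a.val : ℤ) : ℚ) / D) / (2 * Real.pi * I)) =
      -(∑ a : ZMod D, (jacobiSym (a.val : ℤ) D : ℂ) * modularSymbol f ((-(a.val : ℤ) : ℚ) / D)) /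
        (Real.pi * I) by
    rw [eq_div_iff hπI, Finset.sum_mul, ← Finset.sum_neg_distrib]
    refine Finset.sum_congr rfl fun a _ ↦ ?_
    field_simp
    ring]
  rw [sum_jacobiSym_mul_modularSymbol_neg D hD3 f, neg_neg]

end Diagonal

end Literature.NumberTheory.EllipticCurves.Shintani
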